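import Summits.AtomisticToContinuum.FouriersLaw.Theorems.PhononMeanFreePathIncoherentChannelTimeReversal

/-!
# Echo structure of the forecast norm (line `two-horizons-forecast-loss`, crux `IncoherentChannel`)

Helper file of line `two-horizons-forecast-loss` of crux `PhononMeanFreePath.IncoherentChannel`
(stmt-AtomisticToContinuum-11811), stub group "EchoStructure".

Setting: `P = pinnedChain ω₂ lam β γ` (`ω₂, lam, β, γ > 0`), the `(N+1)`-site chain `0..N` with both baths at
`T > 0`, `μ₀ = P.gibbsMeasure (N+1) T`, `K_t = P.transitionKernel (N+1) T T t⁺`, the mean forecast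
`v_t = fcast … N t = K_t p_N` of the far momentum `p_N`, its norm `S_N(t) = fnorm … N t = ‖v_t‖²_{L²(μ₀)}`
(`Theorems/PhononMeanFreePathDefs`) and the ECHO `a_N(t) = ⟨p_N, v_t⟩_{μ₀}`; `Θ(q,p) = (q,-p)` is the momentum
reversal, which preserves `μ₀`.

From the landed time-reversal identity `a_N(2t) = -⟨v_t∘Θ, v_t⟩_{μ₀}` (`echo_timeReversal`,
`Theorems/PhononMeanFreePathIncoherentChannelTimeReversal`) and `‖v_t∘Θ‖ = ‖v_t‖`, expanding the squares:

* `fnorm_add_echo_eq` — `S_N(t) + a_N(2t) = ½ ‖v_t - v_t∘Θ‖²` (twice the squared norm of the `Θ`-odd part);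
* `fnorm_sub_echo_eq` — `S_N(t) - a_N(2t) = ½ ‖v_t + v_t∘Θ‖²` (twice the squared norm of the `Θ`-even part);
* `abs_endAutocorr_le_fnorm_half` — `|⟨p_N, K_t p_N⟩_{μ₀}| ≤ S_N(t/2)` (the echo bound `abs_echo_two_mul_le_fnorm`
  at time `t/2`, with `fcast` unfolded).

So `S_N = ‖odd‖² + ‖even‖²` while `a_N(2·) = ‖odd‖² - ‖even‖²`: the forecast loss `S_N → 0` kills both parts, the
echo only their difference.
-/

noncomputable section

namespace Summit.AtomisticToContinuum.FouriersLaw.Theorems.PhononMeanFreePath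

open MeasureTheory Set Filter Topology
open scoped NNReal
open Literature.MathematicalPhysics.KineticTheory.HeatConduction
open Summit.AtomisticToContinuum.FouriersLaw.Theorems.SubdiffusiveBondHeat (integrable_mul_of_sq_aesm)
open Summit.AtomisticToContinuum.FouriersLaw.Cruxes.SuperadditiveResistance.FloatingProbeBypassLaplacian
  (integral_flip_gibbsMeasure integrable_flip_gibbsMeasure)

/-! ### Expanding the square under the integral -/

/-- `∫ (v - w)² dμ = ∫ v² dμ - 2 ∫ w·v dμ + ∫ w² dμ` for a.e.-strongly measurable `v, w` with `v², w² ∈ L¹(μ)`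
(the cross term is integrable by `2|wv| ≤ w² + v²`). [folklore] -/
theorem echoStructure_integral_sub_sq {X : Type*} [MeasurableSpace X] {μ : Measure X} {v w : X → ℝ}
    (hvm : AEStronglyMeasurable v μ) (hwm : AEStronglyMeasurable w μ)
    (hv : Integrable (fun z => v z ^ 2) μ) (hw : Integrable (fun z => w z ^ 2) μ) :
    ∫ z, (v z - w z) ^ 2 ∂μ = ∫ z, v z ^ 2 ∂μ - 2 * ∫ z, w z * v z ∂μ + ∫ z, w z ^ 2 ∂μ := by
  have hwv : Integrable (fun z => w z * v z) μ := integrable_mul_of_sq_aesm hwm hvm hw hv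
  have h1 : Integrable (fun z => 2 * (w z * v z)) μ := hwv.const_mul 2
  have h2 : Integrable (fun z => v z ^ 2 - 2 * (w z * v z)) μ := hv.sub h1
  have h : ∀ z, (v z - w z) ^ 2 = v z ^ 2 - 2 * (w z * v z) + w z ^ 2 := fun z => by ring
  simp_rw [h]
  rw [integral_add h2 hw, integral_sub hv h1, integral_const_mul]

/-- `∫ (v + w)² dμ = ∫ v² dμ + 2 ∫ w·v dμ + ∫ w² dμ` for a.e.-strongly measurable `v, w` with `v², w² ∈ L¹(μ)`
(the cross term is integrable by `2|wv| ≤ w² + v²`). [folklore] -/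
theorem echoStructure_integral_add_sq {X : Type*} [MeasurableSpace X] {μ : Measure X} {v w : X → ℝ}
    (hvm : AEStronglyMeasurable v μ) (hwm : AEStronglyMeasurable w μ)
    (hv : Integrable (fun z => v z ^ 2) μ) (hw : Integrable (fun z => w z ^ 2) μ) :
    ∫ z, (v z + w z) ^ 2 ∂μ = ∫ z, v z ^ 2 ∂μ + 2 * ∫ z, w z * v z ∂μ + ∫ z, w z ^ 2 ∂μ := by
  have hwv : Integrable (fun z => w z * v z) μ := integrable_mul_of_sq_aesm hwm hvm hw hv
  have h1 : Integrable (fun z => 2 * (w z * v z)) μ := hwv.const_mul 2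
  have h2 : Integrable (fun z => v z ^ 2 + 2 * (w z * v z)) μ := hv.add h1
  have h : ∀ z, (v z + w z) ^ 2 = v z ^ 2 + 2 * (w z * v z) + w z ^ 2 := fun z => by ring
  simp_rw [h]
  rw [integral_add h2 hw, integral_add hv h1, integral_const_mul]

/-! ### The forecast and its momentum reversal -/

section Setting

variable {ω₂ lam β γ T : ℝ} (hω : 0 < ω₂) (hl : 0 ≤ lam) (hβ : 0 ≤ β) (hγ : 0 ≤ γ) (hT : 0 < T)
include hω hl hβ hγ hT

/-- The data of the square expansion for `v = v_t` and `w = v_t∘Θ` under `μ₀`: both are a.e.-strongly measurable,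
`v_t², (v_t∘Θ)² ∈ L¹(μ₀)`, and `∫ (v_t∘Θ)² dμ₀ = S_N(t)` (`Θ` preserves `μ₀`). [folklore] -/
theorem echoStructure_fcast_flip_data (N : ℕ) (t : ℝ) :
    AEStronglyMeasurable (fcast ω₂ lam β γ T N t) ((pinnedChain ω₂ lam β γ).gibbsMeasure (N + 1) T) ∧
      AEStronglyMeasurable (fun z : PhaseSpace (N + 1) => fcast ω₂ lam β γ T N t (z.1, -z.2))
        ((pinnedChain ω₂ lam β γ).gibbsMeasure (N + 1) T) ∧
      Integrable (fun z => fcast ω₂ lam β γ T N t z ^ 2) ((pinnedChain ω₂ lam β γ).gibbsMeasure (N + 1) T) ∧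
      Integrable (fun z : PhaseSpace (N + 1) => fcast ω₂ lam β γ T N t (z.1, -z.2) ^ 2)
        ((pinnedChain ω₂ lam β γ).gibbsMeasure (N + 1) T) ∧
      ∫ z, fcast ω₂ lam β γ T N t (z.1, -z.2) ^ 2 ∂((pinnedChain ω₂ lam β γ).gibbsMeasure (N + 1) T) =
        fnorm ω₂ lam β γ T N t := by
  have hvm : Measurable (fcast ω₂ lam β γ T N t) := lightCone_measurable_fcast ω₂ lam β γ T N t
  have hΘ : Measurable fun z : PhaseSpace (N + 1) => ((z.1, -z.2) : PhaseSpace (N + 1)) :=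
    measurable_fst.prodMk measurable_snd.neg
  have hv2 := (lightCone_fcast_moments ω₂ lam β γ hω hl hβ hγ T hT N t).2.1
  refine ⟨hvm.aestronglyMeasurable, (hvm.comp hΘ).aestronglyMeasurable, hv2,
    integrable_flip_gibbsMeasure (pinnedChain ω₂ lam β γ) (N + 1) T (F := fun z => fcast ω₂ lam β γ T N t z ^ 2) hv2,
    ?_⟩
  unfold fnorm
  exact integral_flip_gibbsMeasure (pinnedChain ω₂ lam β γ) (N + 1) T (fun z => fcast ω₂ lam β γ T N t z ^ 2)

end Setting

/-! ### The registered stubs -/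

/-- **Odd part (registered stub `fnorm_add_echo_eq`).** `S_N(t) + a_N(2t) = ½ ∫ (v_t - v_t∘Θ)² dμ₀` for `t ≥ 0`:
expand the square, `∫ (v_t∘Θ)² = S_N(t)` (`Θ` preserves `μ₀`) and `∫ (v_t∘Θ) v_t = -a_N(2t)`
(`echo_timeReversal` at `s = u = t`). [folklore] -/
theorem fnorm_add_echo_eq : ∀ ω₂ lam β γ : ℝ, 0 < ω₂ → 0 < lam → 0 < β → 0 < γ → ∀ T : ℝ, 0 < T → ∀ N : ℕ, 1 ≤ N → ∀ t : ℝ, 0 ≤ t → fnorm ω₂ lam β γ T N t + ∫ z, z.2 (Fin.last N) * fcast ω₂ lam β γ T N (2 * t) z ∂((pinnedChain ω₂ lam β γ).gibbsMeasure (N + 1) T) = (1 / 2) * ∫ z, (fcast ω₂ lam β γ T N t z - fcast ω₂ lam β γ T N t (z.1, -z.2)) ^ 2 ∂((pinnedChain ω₂ lam β γ).gibbsMeasure (N + 1) T) := by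
  intro ω₂ lam β γ hω hl hβ hγ T hT N hN t ht
  obtain ⟨hvm, hwm, hv2, hw2, hwS⟩ := echoStructure_fcast_flip_data hω hl.le hβ.le hγ.le hT N t
  rw [two_mul, echo_timeReversal ω₂ lam β γ hω hl hβ hγ T hT N hN t t ht ht,
    echoStructure_integral_sub_sq hvm hwm hv2 hw2, hwS]
  unfold fnorm
  ring

/-- **Even part (registered stub `fnorm_sub_echo_eq`).** `S_N(t) - a_N(2t) = ½ ∫ (v_t + v_t∘Θ)² dμ₀` for `t ≥ 0`:
expand the square, `∫ (v_t∘Θ)² = S_N(t)` (`Θ` preserves `μ₀`) and `∫ (v_t∘Θ) v_t = -a_N(2t)`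
(`echo_timeReversal` at `s = u = t`). [folklore] -/
theorem fnorm_sub_echo_eq : ∀ ω₂ lam β γ : ℝ, 0 < ω₂ → 0 < lam → 0 < β → 0 < γ → ∀ T : ℝ, 0 < T → ∀ N : ℕ, 1 ≤ N → ∀ t : ℝ, 0 ≤ t → fnorm ω₂ lam β γ T N t - ∫ z, z.2 (Fin.last N) * fcast ω₂ lam β γ T N (2 * t) z ∂((pinnedChain ω₂ lam β γ).gibbsMeasure (N + 1) T) = (1 / 2) * ∫ z, (fcast ω₂ lam β γ T N t z + fcast ω₂ lam β γ T N t (z.1, -z.2)) ^ 2 ∂((pinnedChain ω₂ lam β γ).gibbsMeasure (N + 1) T) := by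
  intro ω₂ lam β γ hω hl hβ hγ T hT N hN t ht
  obtain ⟨hvm, hwm, hv2, hw2, hwS⟩ := echoStructure_fcast_flip_data hω hl.le hβ.le hγ.le hT N t
  rw [two_mul, echo_timeReversal ω₂ lam β γ hω hl hβ hγ T hT N hN t t ht ht,
    echoStructure_integral_add_sq hvm hwm hv2 hw2, hwS]
  unfold fnorm
  ring

/-- **End autocorrelation bound (registered stub `abs_endAutocorr_le_fnorm_half`).** `|⟨p_N, K_t p_N⟩_{μ₀}| ≤ S_N(t/2)`
for `t ≥ 0`: the echo bound `abs_echo_two_mul_le_fnorm` at time `t/2` (`2·(t/2) = t`), the inner kernel integral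
being `v_t = fcast … N t` by definition. [folklore] -/
theorem abs_endAutocorr_le_fnorm_half : ∀ ω₂ lam β γ : ℝ, 0 < ω₂ → 0 < lam → 0 < β → 0 < γ → ∀ T : ℝ, 0 < T → ∀ N : ℕ, 1 ≤ N → ∀ t : ℝ, 0 ≤ t → |∫ z, z.2 (Fin.last N) * (∫ y, y.2 (Fin.last N) ∂((pinnedChain ω₂ lam β γ).transitionKernel (N + 1) T T t.toNNReal z)) ∂((pinnedChain ω₂ lam β γ).gibbsMeasure (N + 1) T)| ≤ fnorm ω₂ lam β γ T N (t / 2) := by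
  intro ω₂ lam β γ hω hl hβ hγ T hT N hN t ht
  have h := abs_echo_two_mul_le_fnorm ω₂ lam β γ hω hl hβ hγ T hT N hN (t / 2) (by positivity)
  rw [show 2 * (t / 2) = t by ring] at h
  simpa only [fcast] using h

end Summit.AtomisticToContinuum.FouriersLaw.Theorems.PhononMeanFreePath

end
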